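import Mathlib
import HarnessLib
import Summits.CriticalPhenomena.CardyFormulaZ2.Theses.CardyBoundaryCoulombGas
import Literature.Probability.Percolation.Crossings
import Literature.Probability.LatticeModels.PercolationRowTransfer

/-!
# Sketch — crux-ideate `stmt-CriticalPhenomena-5662` (`HalfPlaneOneArmThird`), ideator 2, round 1

First lemmas (signatures over existing declarations; proofs are NOT the point, `sorry` where open)
for the two crux idea cards of this seat:

* card A `lightcone-symplectic-passage`: `stripWall_one` (the L = 3 light-cone value 7/9, provable now),
  `stripWall_le_halfBoxArm` / `halfBoxArm_le_stripWall` (RSW sandwich strip ↔ half-box, provable now),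
  `StripWidthLaw` (the integrable input, exact Ikhlef–Ponsaing ratio ⇒ two-sided `n^{-1/3}`) and
  `crux_of_stripWidthLaw` (the composition, provable now from the sandwich by log-limits);
* card B `third-difference-universal-anchors`: the half-plane 2-arm / 3-arm events of bond-ℤ² written
  WITHOUT dual paths (planar duality in the half-box turns the closed dual arms into absence of open
  crossings between bottom boundary pieces), the universal exponents as named statements, the vanishing
  third difference, and the PROVED reduction `crux_of_thirdDifference`.
-/

namespace Summit.CriticalPhenomena.CardyFormulaZ2.Cruxes.HalfPlaneOneArmThird.IdeatorTwo

open Literature.Probability.Percolation Literature.Probability.LatticeModels MeasureTheory Filter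

noncomputable section

/-- The critical bond-percolation measure on `ℤ²` (`p = 1/2`). -/
abbrev μ : Measure (BondConfig (Site 2)) := bondPercolation (zdGraph 2) half

/-- The lattice half-box `[-n, n] × [0, n]` of the crux. -/
def halfBox (n : ℕ) : Set (Site 2) := {v : Site 2 | 0 ≤ v 1 ∧ -(n : ℤ) ≤ v 0 ∧ v 0 ≤ n ∧ v 1 ≤ n}

/-- The crux's half-plane one-arm event, verbatim: `0` is joined inside the half-box to its outer
boundary `{|v 0| = n} ∪ {v 1 = n}`. -/
def halfBoxArm (n : ℕ) : Set (BondConfig (Site 2)) :=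
  {ω | ∃ y : Site 2, (y 0 = (n : ℤ) ∨ y 0 = -(n : ℤ) ∨ y 1 = (n : ℤ)) ∧
    ω ∈ openConnIn {v : Site 2 | 0 ≤ v 1 ∧ -(n : ℤ) ≤ v 0 ∧ v 0 ≤ n ∧ v 1 ≤ n} 0 y}

/-- The crux is literally the statement that `log μ(halfBoxArm n) / log n → -1/3`. -/
theorem crux_iff :
    Theses.CardyBoundaryCoulombGas.HalfPlaneOneArmThird ↔
      Tendsto (fun n : ℕ ↦ Real.log (μ.real (halfBoxArm n)) / Real.log n) atTop (nhds (-(1 / 3 : ℝ))) :=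
  Iff.rfl

/-! ### Card A — `lightcone-symplectic-passage` -/

/-- STRIP WALL-TO-WALL EVENT: in the horizontal strip `0 ≤ v 1 ≤ n` (bottom wall free), the wall site
`0` is joined inside the strip to the far wall `{v 1 = n}` (wiring the far wall does not change the
event). Its probability is the stationary boundary-passage probability of the axis-parallel strip of
`n + 1` rows, i.e. Ikhlef–Ponsaing's `P_b` at `L = 2n + 1` evaluated at the light-cone point. -/
def stripWallEvent (n : ℕ) : Set (BondConfig (Site 2)) :=
  openCrossing {v : Site 2 | 0 ≤ v 1 ∧ v 1 ≤ n} {0} {v : Site 2 | v 1 = (n : ℤ)}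

/-- DICTIONARY PIN (provable now, geometric series): for the strip of height one the wall-to-wall
probability is `7/9` — exactly the light-cone evaluation `21/27` of Ikhlef–Ponsaing's `L = 3` formula
(`χ₂ χ₄ / χ₃² = 1 · 21 / (3√3)²` at `u = e^{-iπ/6}`), versus `3/4 = 27/36` at the homogeneous point
(diagonal strip). -/
theorem stripWall_one : μ.real (stripWallEvent 1) = 7 / 9 := by
  sorry

/-- SANDWICH, inclusion half (provable now): a wall-to-wall path, stopped at its first exit from the
half-box, is a half-box arm. -/
theorem stripWall_le_halfBoxArm (n : ℕ) : μ.real (stripWallEvent n) ≤ μ.real (halfBoxArm n) := by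
  sorry

/-- SANDWICH, RSW half (provable now from `rsw_half_holds`, `harris_fkg_holds`,
`exists_mem_support_of_crossing`): an arm exiting through a lateral side of the half-box is prolonged
to the far wall by a top–bottom crossing of `[n/2, n] × [0, n]` (or its mirror), at bounded cost. -/
theorem halfBoxArm_le_stripWall :
    ∃ C : ℝ, 0 < C ∧ ∀ n : ℕ, 1 ≤ n → μ.real (halfBoxArm n) ≤ C * μ.real (stripWallEvent n) := by
  sorry

/-- THE INTEGRABLE INPUT of the line (open; = large-`L` analysis of the exact light-cone ratio
`S(L-1) S(L+1) / S(L)²` of `Sp(2m)` characters at the torsion point `u = e^{-iπ/6}`): two-sided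
`n^{-1/3}` bounds for the wall-to-wall probability of the axis-parallel strip. -/
def StripWidthLaw : Prop :=
  ∃ c C : ℝ, 0 < c ∧ ∀ n : ℕ, 1 ≤ n →
    c * (n : ℝ) ^ (-(1 / 3 : ℝ)) ≤ μ.real (stripWallEvent n) ∧
      μ.real (stripWallEvent n) ≤ C * (n : ℝ) ^ (-(1 / 3 : ℝ))

/-- COMPOSITION (provable now from the sandwich: two-sided power bounds ⇒ log-ratio limit). -/
theorem crux_of_stripWidthLaw :
    StripWidthLaw → Theses.CardyBoundaryCoulombGas.HalfPlaneOneArmThird := by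
  sorry


/-! #### The light-cone identity (card A's exact-solvability stub, numerically certified for `N = 1, 2, 3`)

`Jlc m k = h_k(u,…,u,u⁻¹,…,u⁻¹)` (`m` copies of each) at `u = e^{-iπ/6}`, written as the real binomial
sum `∑_{a=0}^{k} C(a+m-1, m-1) C(k-a+m-1, m-1) cos((2a-k)π/6)`; `Slc m` = the symplectic
Jacobi–Trudi determinant of the `Sp(2m)` character with highest weight `λ(m)_i = ⌊(m-i)/2⌋`
evaluated at `m` equal arguments `u` (size `m - 2`; `Slc 1 = Slc 2 = 1`, `Slc 3 = 3√3`, `Slc 4 = 21`,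
`Slc 5 = 531`, `Slc 6 = 9045`, `Slc 7 = 626697√3`, …). -/

/-- Complete homogeneous symmetric polynomial of the alphabet `u^{±1}` (multiplicity `m` each) at the
twelfth root of unity `u = e^{-iπ/6}`, as a real number (`0` for negative degree). -/
def Jlc (m : ℕ) (k : ℤ) : ℝ :=
  if k < 0 then 0 else
    ∑ a ∈ Finset.range (k.toNat + 1),
      ((Nat.choose (a + m - 1) (m - 1) : ℝ) * (Nat.choose (k.toNat - a + m - 1) (m - 1) : ℝ)) *
        Real.cos ((2 * (a : ℝ) - (k.toNat : ℝ)) * Real.pi / 6)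

/-- The symplectic Jacobi–Trudi matrix of `λ(m)` at equal arguments (Fulton–Harris (24.24):
first column `J_{λ_i - i + 1}`, column `j ≥ 2`: `J_{λ_i - i + j} + J_{λ_i - i - j + 2}`; here
0-indexed). -/
def slcMatrix (m : ℕ) : Matrix (Fin (m - 2)) (Fin (m - 2)) ℝ := fun i j =>
  Jlc m (((m - (i.val + 1)) / 2 : ℕ) - (i.val : ℤ) + (j.val : ℤ)) +
    (if j.val = 0 then 0 else Jlc m (((m - (i.val + 1)) / 2 : ℕ) - (i.val : ℤ) - (j.val : ℤ)))

/-- `S(m; e^{-iπ/6})`: the `Sp(2m)` character `sp_{λ(m)}(u, …, u)`. -/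
def Slc (m : ℕ) : ℝ := (slcMatrix m).det

/-- THE LIGHT-CONE IDENTITY (conjecture-grade, exact for every width; verified by exact rational
computation of the stationary strip chain against the determinant for `N = 1, 2, 3`:
`7/9`, `2345/3481`, `12160165/19953723`): the wall-to-wall probability of the axis-parallel strip of
`N + 1` rows is Ikhlef–Ponsaing's symplectic-character ratio at the light-cone point,
`S(2N) S(2N+2) / S(2N+1)²`. Inputs of a proof: Sklyanin double-row transfer matrix with alternating
inhomogeneities `e^{∓iπ/12}` = brick wall of isotropic `(1 + e)/2` tiles; commuting family ⇒ common
Perron vector = the Laurent-polynomial qKZ solution; IP's symmetry/recursion/degree identification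
of `⟨Ψ|ρ|Ψ⟩`. -/
theorem lightcone_passage (N : ℕ) (hN : 1 ≤ N) :
    μ.real (stripWallEvent N) = Slc (2 * N) * Slc (2 * N + 2) / Slc (2 * N + 1) ^ 2 := by
  sorry

/-! ### Card B — `third-difference-universal-anchors` -/

/-- Bottom-boundary pieces of the half-box: `[1, n] × {0}`. -/
def bottomRight (n : ℕ) : Set (Site 2) := {v : Site 2 | v 1 = 0 ∧ 1 ≤ v 0 ∧ v 0 ≤ n}
/-- `[-n, 0] × {0}`. -/
def bottomLeftZero (n : ℕ) : Set (Site 2) := {v : Site 2 | v 1 = 0 ∧ -(n : ℤ) ≤ v 0 ∧ v 0 ≤ 0}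
/-- `[-n, -1] × {0}`. -/
def bottomLeft (n : ℕ) : Set (Site 2) := {v : Site 2 | v 1 = 0 ∧ -(n : ℤ) ≤ v 0 ∧ v 0 ≤ -1}
/-- `[0, n] × {0}`. -/
def bottomRightZero (n : ℕ) : Set (Site 2) := {v : Site 2 | v 1 = 0 ∧ 0 ≤ v 0 ∧ v 0 ≤ n}

/-- HALF-PLANE 2-ARM EVENT (3 legs), dual-free form: an open arm from `0` to the outer boundary of the
half-box AND a closed dual arm from the boundary point `(1/2, 0)` to the outer boundary — by planar
duality in the half-box the latter is the absence of an open crossing inside the half-box between the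
bottom pieces `[1, n] × {0}` and `[-n, 0] × {0}`. Universal exponent `β₂⁺ = 1`. -/
def twoArm (n : ℕ) : Set (BondConfig (Site 2)) :=
  halfBoxArm n ∩ (openCrossing (halfBox n) (bottomRight n) (bottomLeftZero n))ᶜ

/-- HALF-PLANE 3-ARM EVENT (4 legs, pattern closed–open–closed): in addition a closed dual arm from
`(-1/2, 0)`, i.e. no open crossing inside the half-box between `[-n, -1] × {0}` and `[0, n] × {0}`.
Universal exponent `β₃⁺ = 2` ("boundary pivotal" counting). -/
def threeArm (n : ℕ) : Set (BondConfig (Site 2)) :=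
  twoArm n ∩ (openCrossing (halfBox n) (bottomLeft n) (bottomRightZero n))ᶜ

/-- "`E` has half-plane exponent `β`": `log μ(E n) / log n → -β`. -/
def HasArmExponent (E : ℕ → Set (BondConfig (Site 2))) (β : ℝ) : Prop :=
  Tendsto (fun n : ℕ ↦ Real.log (μ.real (E n)) / Real.log n) atTop (nhds (-β))

/-- UNIVERSAL INTEGER 1 (known for bond-`ℤ²` by the leftmost-contact counting argument; to be proved
for this library's measure): the half-plane 2-arm exponent is `1`. -/
def UniversalTwoArm : Prop := HasArmExponent twoArm 1

/-- UNIVERSAL INTEGER 2 (known by boundary-pivotal counting): the half-plane 3-arm exponent is `2`. -/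
def UniversalThreeArm : Prop := HasArmExponent threeArm 2

/-- THE GAUSSIAN INPUT of line B, constant-free: the THIRD finite difference in the number of legs
`ℓ = 1, 2, 3, 4` (arms `0, 1, 2, 3`; the `ℓ = 1` term is the Dobrushin interface, probability `≍ 1`,
omitted) of `log μ(ℓ legs to distance n)` is `o(log n)` — "log-probabilities of boundary leg
insertions are quadratic in the leg number", with NEITHER the stiffness NOR the background charge
entering. -/
def ThirdDifferenceVanishes : Prop :=
  Tendsto (fun n : ℕ ↦ (Real.log (μ.real (threeArm n)) - 3 * Real.log (μ.real (twoArm n)) +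
      3 * Real.log (μ.real (halfBoxArm n))) / Real.log n) atTop (nhds 0)

/-- REDUCTION of line B (proved): the two universal integers and the vanishing third difference give
`β₁⁺ = 1/3`, i.e. the crux. (Arithmetic: `β₁ = (0 - (-2) + 3·(-1)) / 3`... precisely
`log μ(A₁)/log n = (Δ³ - log μ(A₃)/log n + 3 log μ(A₂)/log n)/3 → (0 + 2 - 3)/3 = -1/3`.) -/
theorem crux_of_thirdDifference (h2 : UniversalTwoArm) (h3 : UniversalThreeArm)
    (hΔ : ThirdDifferenceVanishes) : Theses.CardyBoundaryCoulombGas.HalfPlaneOneArmThird := by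
  rw [crux_iff]
  have key : (fun n : ℕ ↦ Real.log (μ.real (halfBoxArm n)) / Real.log n) = fun n : ℕ ↦
      ((Real.log (μ.real (threeArm n)) - 3 * Real.log (μ.real (twoArm n)) +
          3 * Real.log (μ.real (halfBoxArm n))) / Real.log n -
        Real.log (μ.real (threeArm n)) / Real.log n +
        3 * (Real.log (μ.real (twoArm n)) / Real.log n)) / 3 := by
    funext n
    ring
  rw [key]
  have hlim : Tendsto (fun n : ℕ ↦
      ((Real.log (μ.real (threeArm n)) - 3 * Real.log (μ.real (twoArm n)) +
          3 * Real.log (μ.real (halfBoxArm n))) / Real.log n -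
        Real.log (μ.real (threeArm n)) / Real.log n +
        3 * (Real.log (μ.real (twoArm n)) / Real.log n)) / 3) atTop
      (nhds (((0 : ℝ) - (-2) + 3 * (-1)) / 3)) :=
    ((hΔ.sub h3).add (h2.const_mul 3)).div_const 3
  have hval : ((0 : ℝ) - (-2) + 3 * (-1)) / 3 = -(1 / 3 : ℝ) := by norm_num
  rw [hval] at hlim
  exact hlim


/-- THE "THREE PAIRS" FORM (uses ONE universal integer): with legs `ℓ = 0, 1` trivial (no condition /
the Dobrushin interface, probability `1`) the third difference on `ℓ ∈ {0,1,2,3}` reads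
"two arms cost exactly one arm cubed": `log μ(A₂ n) - 3 log μ(A₁ n) = o(log n)`, i.e. `β₂⁺ = 3 β₁⁺` —
each of the three pairs among the three strands of the 2-arm configuration repels like the single
pair of the 1-arm configuration. -/
def OneArmCubedIsTwoArm : Prop :=
  Tendsto (fun n : ℕ ↦ (Real.log (μ.real (twoArm n)) - 3 * Real.log (μ.real (halfBoxArm n))) /
    Real.log n) atTop (nhds 0)

/-- REDUCTION, three-pairs form (proved): `β₂⁺ = 1` and "one arm cubed is two arms" give the crux. -/
theorem crux_of_oneArmCubed (h2 : UniversalTwoArm) (hc : OneArmCubedIsTwoArm) :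
    Theses.CardyBoundaryCoulombGas.HalfPlaneOneArmThird := by
  rw [crux_iff]
  have key : (fun n : ℕ ↦ Real.log (μ.real (halfBoxArm n)) / Real.log n) = fun n : ℕ ↦
      (Real.log (μ.real (twoArm n)) / Real.log n -
        (Real.log (μ.real (twoArm n)) - 3 * Real.log (μ.real (halfBoxArm n))) / Real.log n) / 3 := by
    funext n
    ring
  rw [key]
  have hlim := (h2.sub hc).div_const 3
  have hval : ((-1 : ℝ) - 0) / 3 = -(1 / 3 : ℝ) := by norm_num
  rw [hval] at hlim
  exact hlim

end

end Summit.CriticalPhenomena.CardyFormulaZ2.Cruxes.HalfPlaneOneArmThird.IdeatorTwo
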